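import Summits.RiemannHypothesis.RiemannHypothesis.Theorems.MotivicDoorFunctionFieldPeriods

/-!
# The function-field door (FF-DOOR, statement (ii)), exact form — part 2: WHICH powers of an RH-true
# Weil datum are geometric — the exponent set is `L · ℕ_{>0}`, computed from Honda–Tate periods
(pub-rhdoor, seat ff-2, gen 3; HONEST FRAMING: lottery ticket at the motivic door; RH probability
negligible; consolation prizes are real: a new semi-local Weil-positivity theorem, or a located gap in the
Connes–Consani programme, plus the ff-door theorem.  Nothing in this file is a statement about `ζ`.)

Setting as in `MotivicDoorFunctionField`: `K = 𝔽_q` finite, `h ∈ ℤ[X]` monic of positive degree,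
`RH(q, h) := ∀ α ∈ frobRoots h, |α| = √q`, GEOMETRIC ORIGIN of a polynomial `P` := `∃ C : AbelianVariety K,
C.IsFrobCharpoly P`.  The door theorem there (`rh_iff_exists_pow_geometric`) says
`RH(q, h) ↔ ∃ E ≥ 1, h^E geometric`, and its caveat (1) (HOME/FF-DOOR.md §(ii) C.1) recorded informally
that the exponent cannot be dropped and that the admissible exponents are governed by Honda–Tate's `e`.
THIS FILE makes that caveat a theorem: it computes the exact set of admissible exponents.

Inputs.  Four NAMED LITERATURE HYPOTHESES (D-0014; verbatim sources in the two Literature files):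
`hW : ∀ A, A.weilRiemannHypothesis` and `hHT : hondaTateExistence K` (`AbelianVarietyHondaTate`: Weil;
Honda–Tate existence `P_A = m^e` for some simple `A`, `e ≥ 1`), and the two new ones of
`AbelianVarietyTateSimpleCharpoly`: `hT : tateSimpleRigidity K` (Tate, Bourbaki 352 Th. 1 (i) + p. 99 /
Waterhouse 1969 p. 526 "THEOREM (Tate)": simple abelian varieties whose `P_A` share a complex root have
equal `P_A`) and `hPW : frobCharpolyProdSimple K` (Poincaré–Weil over `k` + isogeny invariance, Tate
p. 95 / Waterhouse p. 522 / Zywina 2014 § 2.1: `P_C` is a product of `P_{A_i}`, `A_i` simple).  Each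
theorem below names exactly the hypotheses it uses.

Vocabulary from part 1 (`MotivicDoorFunctionFieldPeriods`): `IsHTPeriod K m e` — "`e ≥ 1` and
`m^e = P_A` for some `K`-simple `A`" (unique under `hT`: `IsHTPeriod.unique`, Waterhouse p. 527 "`π`
determines `e`"); a PERIOD FAMILY assigns a period `e_m` to every monic irreducible factor `m` of `h`, and
exists iff `RH(q, h)` (`rh_iff_exists_periodFamily`, from hW / hHT).

PROVED here (kernel; labels per item; `mult_m(h)` = `multiplicity m h` in the UFD `ℤ[X]`):
* `isFrobCharpoly_pow_iff_forall_period_dvd` — **EXACT EXPONENT THEOREM**: for `h` monic of positive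
  degree with a period family `e` and `E ≥ 1`:
  `h^E is geometric over 𝔽_q ↔ ∀ m (monic irreducible, m ∣ h), e_m ∣ E · mult_m(h)`.
  [PROVED from hT, hPW for (⇒) — `period_dvd_of_isFrobCharpoly_pow`: decompose `h^E = ∏ P_{A_i}`, each
  `P_{A_i}` divisible by `m` equals `m^{e_m}` by rigidity, multiplicities add; (⇐) —
  `exists_isFrobCharpoly_pow_of_period_dvd` — uses NO named fact: `h^E = ∏_m (m^{e_m})^{(E·mult_m h)/e_m}`
  is a product of powers of the `P_{A_m}`, and products / powers of abelian varieties are abelian varieties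
  (`exists_isFrobCharpoly_mul/pow`, PROVED in the tree).]
* `isFrobCharpoly_iff_forall_period_dvd_multiplicity` — the case `E = 1`: **`h` itself is geometric iff
  `e_m ∣ mult_m(h)` for every factor** — the precise sense in which "honest fake vs genuine" is decided by
  Honda–Tate's arithmetic `e` and the factor multiplicities, not by root location.  [PROVED from hT, hPW]
* `isFrobCharpoly_irreducible_iff_period_eq_one` — an irreducible Weil polynomial is a `P_A` iff its
  period is `1` (Waterhouse p. 528 "`h_A` irreducible iff `e = 1`", one direction of which is here a
  theorem about ALL abelian varieties with that characteristic polynomial).  [PROVED from hT, hPW]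
* `exists_generator_of_admissible_exponents` — the admissible exponents `{E ≥ 1 : h^E geometric}` are
  exactly the positive multiples of one `L ≥ 1` (informally `L = lcm_m (e_m / gcd(e_m, mult_m h))`; here
  the least admissible exponent, closed under remainders).  [PROVED from hT, hPW]
* `rh_exact_exponent_set` — the package: RH-true `h` ⇒ a period family exists, the exact exponent
  criterion for every `E ≥ 1`, and the generator `L`.  [PROVED from hHT, hT, hPW]
* Instance reading (DATA / cited, not formalised): `x² - 7x + 49` over `𝔽_49` is irreducible with period
  `e = 2` (Waterhouse Thm. 4.1 / Honda–Tate invariants `1/2, 1/2`), so by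
  `isFrobCharpoly_irreducible_iff_period_eq_one` it is NOT a `P_A` while its square is: `L = 2`; for
  `x² - 2x + 4` over `𝔽_4`, `e = 1` and `L = 1`.

What this adds to the door (HOME/FF-DOOR.md §(ii)): caveat C.1 "POWERS" is now a theorem with an exact
criterion, modulo two further classical facts recorded by name; the (⇐) direction — building the abelian
variety from the periods — is unconditional.  Nothing here bears on the number-field door except as the
precise statement of what "geometric origin" means past RH on the function-field side: an arithmetic
divisibility condition on Brauer periods, invisible to root location and to every window functional
(`exists_geometric_scaleInvariant_eq` in the sibling file).
-/

set_option linter.dupNamespace false  -- the mandated namespace repeats `RiemannHypothesis`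

open Polynomial

namespace Summit.RiemannHypothesis.RiemannHypothesis.Theorems.MotivicDoor.FunctionField

open Literature.AlgebraicGeometry.Motives
open Summit.RiemannHypothesis.RiemannHypothesis.Theorems.PfPersistence.FfAngleTwin

universe u

variable {K : Type u} [Field K] [Finite K]/-! ### The exact exponent theorem -/

/-- **(⇒) Divisibility.**  If `h^E` (`h` monic, `E ≥ 1`) is the characteristic polynomial of the
Frobenius of an abelian variety over `K`, then for every monic irreducible factor `m` of `h` with
Honda–Tate period `e_m`: `e_m ∣ E · mult_m(h)`.  Uses BOTH named facts: the decomposition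
`h^E = ∏ P_{A_i}` (`frobCharpolyProdSimple`) and rigidity `m ∣ P_{A_i} ⟹ P_{A_i} = m^{e_m}`
(`tateSimpleRigidity`), then multiplicities are additive. [PROVED from the named facts] -/
theorem period_dvd_of_isFrobCharpoly_pow (hT : AbelianVariety.tateSimpleRigidity K)
    (hPW : AbelianVariety.frobCharpolyProdSimple K) {h : ℤ[X]} (hh : h.Monic) (hdeg : 0 < h.natDegree)
    {E : ℕ} (hE : 0 < E) {C : AbelianVariety K} (hC : C.IsFrobCharpoly (h ^ E)) {m : ℤ[X]}
    (hm : m.Monic) (hirr : Irreducible m) {em : ℕ} (hem : IsHTPeriod K m em) :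
    em ∣ E * multiplicity m h := by
  classical
  have hp : Prime m := UniqueFactorizationMonoid.irreducible_iff_prime.1 hirr
  have hCdim : 0 < C.dim := hC.dim_pos (by rw [hh.natDegree_pow]; exact Nat.mul_pos hE hdeg)
  obtain ⟨n, A, Q, hAQ, hprod⟩ := hPW C hCdim (h ^ E) hC
  have hfin : FiniteMultiplicity m h := FiniteMultiplicity.of_not_isUnit hirr.not_isUnit hh.ne_zero
  have hmult : multiplicity m (h ^ E) = E * multiplicity m h := hfin.multiplicity_pow hp
  rw [hprod, multiplicity_prod_eq_sum hp _ _ (fun i _ => (hAQ i).2.2.monic.ne_zero)] at hmult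
  have hterm : ∀ i, multiplicity m (Q i) = if m ∣ Q i then em else 0 := by
    intro i
    split_ifs with hi
    · rw [hem.eq_pow_of_dvd hT hm hirr (hAQ i).1 (hAQ i).2.1 (hAQ i).2.2 hi,
        multiplicity_pow_self_of_prime hp]
    · exact multiplicity_eq_zero.2 hi
  simp only [hterm, Finset.sum_ite, Finset.sum_const_zero, add_zero, Finset.sum_const, smul_eq_mul] at hmult
  exact ⟨_, by rw [← hmult, mul_comm]⟩

/-- **(⇐) Construction.**  If every monic irreducible factor `m` of the monic `h` (positive degree) has a
Honda–Tate period `e_m` with `e_m ∣ E · mult_m(h)` (`E ≥ 1`), then `h^E` is the characteristic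
polynomial of the Frobenius of an abelian variety over `K`: `h^E = ∏_m (m^{e_m})^{E·mult_m(h)/e_m}` is
a product of powers of the `P_{A_m}` (products and powers of abelian varieties,
`exists_isFrobCharpoly_mul/pow`).  No named fact is used. [PROVED] -/
theorem exists_isFrobCharpoly_pow_of_period_dvd {h : ℤ[X]} (hh : h.Monic) (hdeg : 0 < h.natDegree)
    {E : ℕ} (hE : 0 < E) {e : ℤ[X] → ℕ}
    (he : ∀ m : ℤ[X], m.Monic → Irreducible m → m ∣ h → IsHTPeriod K m (e m))
    (hdiv : ∀ m : ℤ[X], m.Monic → Irreducible m → m ∣ h → e m ∣ E * multiplicity m h) :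
    ∃ C : AbelianVariety K, C.IsFrobCharpoly (h ^ E) := by
  revert hdeg he hdiv
  refine monic_peel_induction (Pr := fun h => 0 < h.natDegree →
      (∀ m : ℤ[X], m.Monic → Irreducible m → m ∣ h → IsHTPeriod K m (e m)) →
      (∀ m : ℤ[X], m.Monic → Irreducible m → m ∣ h → e m ∣ E * multiplicity m h) →
      ∃ C : AbelianVariety K, C.IsFrobCharpoly (h ^ E)) ?_ ?_ h hh
  · intro h0 _ _
    simp at h0
  · intro m k g hm hirr hk hg hndvd ih _ he hdiv
    have hmh : m ∣ m ^ k * g := dvd_mul_of_dvd_left (dvd_pow_self m hk.ne') g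
    -- the factor `m`: its period divides `E k`
    have hem := he m hm hirr hmh
    have hdm := hdiv m hm hirr hmh
    rw [multiplicity_pow_mul_of_not_dvd hirr k hg.ne_zero hndvd] at hdm
    obtain ⟨t, ht⟩ := hdm
    obtain ⟨hem0, Am, -, hAm⟩ := hem
    have htpos : 0 < t := by
      rcases Nat.eq_zero_or_pos t with rfl | htpos
      · exact absurd ht (by rw [mul_zero]; exact (Nat.mul_pos hE hk).ne')
      · exact htpos
    obtain ⟨C₁, hC₁⟩ := AbelianVariety.exists_isFrobCharpoly_pow hAm htpos
    rw [← pow_mul, ← ht] at hC₁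
    -- `hC₁ : C₁.IsFrobCharpoly (m ^ (E * k))`
    rcases Nat.eq_zero_or_pos g.natDegree with hg0 | hgpos
    · rw [Polynomial.eq_one_of_monic_natDegree_zero hg hg0, mul_one, ← pow_mul, mul_comm k E]
      exact ⟨C₁, hC₁⟩
    · -- the cofactor, by induction
      have heg : ∀ m' : ℤ[X], m'.Monic → Irreducible m' → m' ∣ g → IsHTPeriod K m' (e m') :=
        fun m' hm' hirr' hd => he m' hm' hirr' (hd.trans (dvd_mul_left g _))
      have hdivg : ∀ m' : ℤ[X], m'.Monic → Irreducible m' → m' ∣ g → e m' ∣ E * multiplicity m' g := by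
        intro m' hm' hirr' hd
        have hne : m' ≠ m := by rintro rfl; exact hndvd hd
        have := hdiv m' hm' hirr' (hd.trans (dvd_mul_left g _))
        rwa [multiplicity_pow_mul_of_ne hm hirr hm' hirr' hne k hg.ne_zero] at this
      obtain ⟨C₂, hC₂⟩ := ih hgpos heg hdivg
      obtain ⟨C, hC⟩ := AbelianVariety.exists_isFrobCharpoly_mul hC₁ hC₂
      refine ⟨C, ?_⟩
      rwa [mul_pow, ← pow_mul, mul_comm k E]

/-- **EXACT EXPONENT THEOREM (FF-DOOR (ii), caveat C.1 made a theorem).**  Over the finite field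
`K = 𝔽_q`, GIVEN Tate's theorem (`tateSimpleRigidity K`) and the Poincaré–Weil decomposition
(`frobCharpolyProdSimple K`): for a monic `h ∈ ℤ[X]` of positive degree, a family `e` assigning a
Honda–Tate period to each monic irreducible factor of `h`, and `E ≥ 1`,
`h^E` is the characteristic polynomial of the Frobenius of an abelian variety over `K`
**iff** `e_m ∣ E · mult_m(h)` for every monic irreducible factor `m` of `h`.
[PROVED modulo the two named Literature hypotheses; (⇐) uses neither] -/
theorem isFrobCharpoly_pow_iff_forall_period_dvd (hT : AbelianVariety.tateSimpleRigidity K)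
    (hPW : AbelianVariety.frobCharpolyProdSimple K) {h : ℤ[X]} (hh : h.Monic) (hdeg : 0 < h.natDegree)
    {e : ℤ[X] → ℕ} (he : ∀ m : ℤ[X], m.Monic → Irreducible m → m ∣ h → IsHTPeriod K m (e m))
    {E : ℕ} (hE : 0 < E) :
    (∃ C : AbelianVariety K, C.IsFrobCharpoly (h ^ E)) ↔
      ∀ m : ℤ[X], m.Monic → Irreducible m → m ∣ h → e m ∣ E * multiplicity m h :=
  ⟨fun ⟨_, hC⟩ m hm hirr hdvd =>
      period_dvd_of_isFrobCharpoly_pow hT hPW hh hdeg hE hC hm hirr (he m hm hirr hdvd),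
    exists_isFrobCharpoly_pow_of_period_dvd hh hdeg hE he⟩

/-- **The case `E = 1`: when is `h` ITSELF geometric?**  Iff `e_m ∣ mult_m(h)` for every monic
irreducible factor `m`. [PROVED modulo the two named hypotheses] -/
theorem isFrobCharpoly_iff_forall_period_dvd_multiplicity (hT : AbelianVariety.tateSimpleRigidity K)
    (hPW : AbelianVariety.frobCharpolyProdSimple K) {h : ℤ[X]} (hh : h.Monic) (hdeg : 0 < h.natDegree)
    {e : ℤ[X] → ℕ} (he : ∀ m : ℤ[X], m.Monic → Irreducible m → m ∣ h → IsHTPeriod K m (e m)) :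
    (∃ C : AbelianVariety K, C.IsFrobCharpoly h) ↔
      ∀ m : ℤ[X], m.Monic → Irreducible m → m ∣ h → e m ∣ multiplicity m h := by
  have H := isFrobCharpoly_pow_iff_forall_period_dvd hT hPW hh hdeg he Nat.one_pos
  simp only [pow_one, one_mul] at H
  exact H

/-- **An irreducible Weil polynomial is a Frobenius characteristic polynomial iff its Honda–Tate period
is `1`** (cf. Waterhouse p. 528: "`h_A` irreducible iff `e = 1`"). [PROVED modulo the two named
hypotheses] -/
theorem isFrobCharpoly_irreducible_iff_period_eq_one (hT : AbelianVariety.tateSimpleRigidity K)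
    (hPW : AbelianVariety.frobCharpolyProdSimple K) {m : ℤ[X]} (hm : m.Monic) (hirr : Irreducible m)
    {em : ℕ} (hem : IsHTPeriod K m em) :
    (∃ C : AbelianVariety K, C.IsFrobCharpoly m) ↔ em = 1 := by
  have hmdeg : 0 < m.natDegree := hm.natDegree_pos.2 hirr.ne_one
  have he : ∀ m' : ℤ[X], m'.Monic → Irreducible m' → m' ∣ m → IsHTPeriod K m' ((fun _ => em) m') := by
    intro m' hm' hirr' hd
    rw [eq_of_monic_irreducible_dvd hm hirr hm' hirr' hd]
    exact hem
  rw [isFrobCharpoly_iff_forall_period_dvd_multiplicity hT hPW hm hmdeg he]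
  constructor
  · intro H
    have := H m hm hirr dvd_rfl
    rw [multiplicity_self] at this
    exact Nat.dvd_one.1 this
  · rintro rfl m' - - -
    exact one_dvd _

/-- **The admissible exponents form the positive multiples of one number.**  Under the two named
hypotheses, for monic `h` of positive degree with a period family: there is `L ≥ 1` with
`(h^E geometric) ⟺ L ∣ E` for all `E ≥ 1` (`L = lcm_m e_m / gcd(e_m, mult_m h)`; here obtained as the
least admissible exponent, by Euclidean division). [PROVED modulo the two named hypotheses] -/
theorem exists_generator_of_admissible_exponents (hT : AbelianVariety.tateSimpleRigidity K)
    (hPW : AbelianVariety.frobCharpolyProdSimple K) {h : ℤ[X]} (hh : h.Monic) (hdeg : 0 < h.natDegree)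
    {e : ℤ[X] → ℕ} (he : ∀ m : ℤ[X], m.Monic → Irreducible m → m ∣ h → IsHTPeriod K m (e m)) :
    ∃ L : ℕ, 0 < L ∧ ∀ E : ℕ, 0 < E →
      ((∃ C : AbelianVariety K, C.IsFrobCharpoly (h ^ E)) ↔ L ∣ E) := by
  classical
  -- the admissibility predicate, in arithmetic form
  let S : ℕ → Prop := fun E => ∀ m : ℤ[X], m.Monic → Irreducible m → m ∣ h → e m ∣ E * multiplicity m h
  have hS : ∀ E, 0 < E → ((∃ C : AbelianVariety K, C.IsFrobCharpoly (h ^ E)) ↔ S E) :=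
    fun E hE => isFrobCharpoly_pow_iff_forall_period_dvd hT hPW hh hdeg he hE
  obtain ⟨E₀, hE₀, hE₀S⟩ := exists_pos_forall_period_dvd hh he
  have hex : ∃ E, 0 < E ∧ S E := ⟨E₀, hE₀, fun m hm hirr hd => (hE₀S m hm hirr hd).mul_right _⟩
  refine ⟨Nat.find hex, (Nat.find_spec hex).1, fun E hE => ?_⟩
  rw [hS E hE]
  set L := Nat.find hex with hL
  have hLpos : 0 < L := (Nat.find_spec hex).1
  have hLS : S L := (Nat.find_spec hex).2
  constructor
  · intro hSE
    -- `S (E % L)`, so `E % L = 0` by minimality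
    have hr : S (E % L) := by
      intro m hm hirr hd
      have h1 := hSE m hm hirr hd
      have h2 : e m ∣ L * (E / L) * multiplicity m h := by
        rw [mul_right_comm]; exact (hLS m hm hirr hd).mul_right _
      rw [← Nat.div_add_mod E L, add_mul] at h1
      exact (Nat.dvd_add_right h2).1 h1
    by_contra hnd
    have hrpos : 0 < E % L := Nat.pos_of_ne_zero fun h0 => hnd (Nat.dvd_of_mod_eq_zero h0)
    have hle : L ≤ E % L := Nat.find_min' hex ⟨hrpos, hr⟩
    exact absurd (Nat.mod_lt E hLpos) (not_lt.2 hle)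
  · rintro ⟨c, rfl⟩ m hm hirr hd
    rw [mul_right_comm]
    exact (hLS m hm hirr hd).mul_right _

/-- **PACKAGE: the exact exponent set of an RH-true Weil datum.**  Over `K = 𝔽_q`, GIVEN Honda–Tate
existence (`hHT`), Tate's theorem (`hT`) and the Poincaré–Weil decomposition (`hPW`): an RH-true monic
`h ∈ ℤ[X]` of positive degree has a period family `e`, and then for every `E ≥ 1`, `h^E` is geometric
iff `e_m ∣ E · mult_m(h)` for all monic irreducible `m ∣ h`; the admissible `E` are the positive
multiples of a single `L ≥ 1`.  (Weil's theorem `hW` is needed only for the converse RH ⇐ period family,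
`rh_iff_exists_periodFamily`.) [PROVED modulo the three named Literature hypotheses] -/
theorem rh_exact_exponent_set (hHT : AbelianVariety.hondaTateExistence K)
    (hT : AbelianVariety.tateSimpleRigidity K)
    (hPW : AbelianVariety.frobCharpolyProdSimple K) {h : ℤ[X]} (hh : h.Monic) (hdeg : 0 < h.natDegree)
    (hRH : ∀ α ∈ frobRoots h, ‖α‖ = Real.sqrt (Nat.card K)) :
    ∃ e : ℤ[X] → ℕ, (∀ m : ℤ[X], m.Monic → Irreducible m → m ∣ h → IsHTPeriod K m (e m)) ∧
      (∀ E : ℕ, 0 < E → ((∃ C : AbelianVariety K, C.IsFrobCharpoly (h ^ E)) ↔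
        ∀ m : ℤ[X], m.Monic → Irreducible m → m ∣ h → e m ∣ E * multiplicity m h)) ∧
      ∃ L : ℕ, 0 < L ∧ ∀ E : ℕ, 0 < E → ((∃ C : AbelianVariety K, C.IsFrobCharpoly (h ^ E)) ↔ L ∣ E) := by
  obtain ⟨e, he⟩ := exists_periodFamily_of_rh hHT hh hRH
  exact ⟨e, he, fun E hE => isFrobCharpoly_pow_iff_forall_period_dvd hT hPW hh hdeg he hE,
    exists_generator_of_admissible_exponents hT hPW hh hdeg he⟩

end Summit.RiemannHypothesis.RiemannHypothesis.Theorems.MotivicDoor.FunctionField
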